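import Literature.NumberTheory.LFunctions.Zhang2022.Section2MainOrder
import Literature.NumberTheory.LFunctions.Zhang2022.Section18DefsE
import Literature.NumberTheory.LFunctions.Zhang2022.Section18Margin232D

/-!
# Zhang (2022) §2 / §18: the final step at main order with `𝔠₃` re-read at a μ₁-value `e1pp`
# (RT-08 honesty record: it does not close at the DERIVED `e″` either)

Trunk T-ANT (NumberTheory/LFunctions). Y. Zhang, *Discrete mean estimates and the Landau–Siegel
zero*, arXiv:2211.02515v1 [Zhang2022LandauSiegel] — an unrefereed manuscript under adjudication;
**nothing in this file asserts or denies its Theorems 1–2**, and nothing here is a claim about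
Landau–Siegel zeros: these are ARITHMETIC corollaries of the tree's certified brackets.

`Section2MainOrder` records the printed final step of §2 at main order in `𝔞𝔓`,
`MainOrderContradiction c₂₃₂ c₂₃₃ :⟺ √(c₂₃₂·c₂₃₃) < |𝔡′ + 𝔡|` ((2.18) with Props. 2.4–2.6 and Cauchy
on (2.32)–(2.33)), and that it fails for the STATED constants (`not_mainOrderContradiction_all`:
`C₂₃₂ > 0.05534` against the requirement `C₂₃₂ < |𝔡′ + 𝔡|²/C₂₃₃ < 0.011026`, `mainOrder_threshold`).
The discharge lane (ZHANG-L, rulings R-28/RT-05 and R-35/RT-08) re-reads the `𝔢`-chain of §§15–18 at a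
parameter `e1pp : ℕ → ℂ` for the μ = 1 values `e″₁ⱼ` (`Section18DefsE.frakc3E e1pp`; `e1ppj` = the
values STATED in Lemma 15.1/(B.3), `e1ppD = −jπi·b*` = the values Appendix B DERIVES), and takes as
terminal hypothesis of record `MainOrderContradiction (𝔠₁ + 𝔠₂ᶜ + 2·Re 𝔠₃ᴱ(e1ppD)) C₂₃₃`.
This file is the honesty record for that terminal: with the kernel brackets `frakc1_re_bounds`
(`𝔠₁ > 7.0501`, §8 certificate), `frakc2c_re_bounds` (`𝔠₂ᶜ > 6.987092`, favourable prefactor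
reading), `frakc3_re_bounds` / `frakc3D_re_bounds` (`Re 𝔠₃ < −6.990998`, `Re 𝔠₃ᴰ < −6.99093`),
`dsum_normSq_bounds` (`|𝔡′ + 𝔡|² < 28.0792`) and `C233_bounds` (`C₂₃₃ > 2546.8476`):

* `c232E_e1ppD_bounds` : `0.055328 < 𝔠₁ + 𝔠₂ᶜ + 2Re 𝔠₃ᴱ(e1ppD) < 0.055343`;
  `c232E_e1ppj_bounds` : `0.055194 < 𝔠₁ + 𝔠₂ᶜ + 2Re 𝔠₃ᴱ(e1ppj) < 0.055207`
  (the reduced `C₂₃₂ᶜ ∈ (0.05534, 0.05536)` of `Section2MainOrder` uses `frakc3r`; the differences are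
  the `𝔢₀`/residual readings of `Section18Defs`, all `< 2·10⁻⁴`);
* `not_mainOrderContradiction_of_le` : `28.0792 ≤ c₂₃₂·c₂₃₃ → ¬ MainOrderContradiction c₂₃₂ c₂₃₃`;
  `not_mainOrderContradiction_C233_of_le` : `0.011026 ≤ c₂₃₂ → ¬ MainOrderContradiction c₂₃₂ C₂₃₃`;
* `not_mainOrderContradiction_cD` / `_cE` : the terminal hypothesis of record is FALSE at the derived
  AND at the stated `e″` (requirement `< 0.011026`, certified `> 0.0553`: a factor `> 5`);
  `_cD_fallback` / `_cE_fallback` : the same against the fallback `c₂₃₃ = 8800/π`;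
  `mainOrderE_refuted_all_readings` : the conjunction, plus the printed-`𝔠₂` reading.

* rev 2 (R-35b/c): the constant OF RECORD includes the `10⁻⁵` tolerance of (18.1) and is `k`-parametric,
  `c232E e1pp k := frakc1.re + k + 2 * ((frakc3E e1pp).re + 1e-5)` (skeleton's definition): brackets
  `c232E_e1ppD_tol_bounds` (0.055348, 0.055363), `c232E_e1ppj_tol_bounds` (0.055214, 0.055227), and
  `not_mainOrderContradiction_cD_with_of_le` (every `k ≥ frakc2c.re`) with the record instances
  `not_mainOrderContradiction_cD_record` (= `¬ MainOrderContradiction (c232E e1ppD frakc2c.re) C233` on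
  unfolding), `_cE_record`, `_c2D_record`, fallbacks, `mainOrderE_record_refuted_all`.

Theorems only; every statement is over the literal sum and is the unfolding of the skeleton's `c232E`.
-/

noncomputable section

open Complex Real

namespace Literature.NumberTheory.LFunctions.Zhang2022

/-! ## Certified brackets for the (2.32)-constant at a μ₁-value -/

/-- **`0.055328 < 𝔠₁ + 𝔠₂ᶜ + 2·Re 𝔠₃ᴱ(e1ppD) < 0.055343`** (derived `e″ = −jπi·b*`; `frakc3E e1ppD = frakc3D`
by `rfl`; brackets `7.0501 < 𝔠₁ < 7.05011`, `6.987092 < 𝔠₂ᶜ < 6.987093`, `−6.990932 < Re 𝔠₃ᴰ < −6.99093`).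
[cite: Zhang2022LandauSiegel, §18 (18.1)–(18.2), (2.32)] -/
theorem c232E_e1ppD_bounds :
    (0.055328 : ℝ) < frakc1.re + frakc2c.re + 2 * (frakc3E e1ppD).re ∧
      frakc1.re + frakc2c.re + 2 * (frakc3E e1ppD).re < 0.055343 := by
  rw [← frakc3D_eq_frakc3E_e1ppD]
  have h1 := frakc1_re_bounds
  have h2 := frakc2c_re_bounds
  have h3 := frakc3D_re_bounds
  constructor <;> linarith [h1.1, h1.2, h2.1, h2.2, h3.1, h3.2]

/-- **`0.055194 < 𝔠₁ + 𝔠₂ᶜ + 2·Re 𝔠₃ᴱ(e1ppj) < 0.055207`** (stated `e″`; `frakc3E e1ppj = frakc3` by `rfl`;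
bracket `−6.990999 < Re 𝔠₃ < −6.990998`). [cite: Zhang2022LandauSiegel, §18 (18.1)–(18.2), (2.32)] -/
theorem c232E_e1ppj_bounds :
    (0.055194 : ℝ) < frakc1.re + frakc2c.re + 2 * (frakc3E e1ppj).re ∧
      frakc1.re + frakc2c.re + 2 * (frakc3E e1ppj).re < 0.055207 := by
  rw [← frakc3_eq_frakc3E_e1ppj]
  have h1 := frakc1_re_bounds
  have h2 := frakc2c_re_bounds
  have h3 := frakc3_re_bounds
  constructor <;> linarith [h1.1, h1.2, h2.1, h2.2, h3.1, h3.2]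

/-- The printed-`𝔠₂` reading only raises the constant: `𝔠₂ᶜ ≤ 𝔠₂`, so
`0.06314 < 𝔠₁ + 𝔠₂ + 2·Re 𝔠₃ᴱ(e1ppD) < 0.06317`. [cite: Zhang2022LandauSiegel, §18 (18.2), (2.32)] -/
theorem c232E2_e1ppD_bounds :
    (0.06314 : ℝ) < frakc1.re + frakc2.re + 2 * (frakc3E e1ppD).re ∧
      frakc1.re + frakc2.re + 2 * (frakc3E e1ppD).re < 0.06317 := by
  rw [← frakc3D_eq_frakc3E_e1ppD]
  have h1 := frakc1_re_bounds
  have h2 := frakc2_re_bounds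
  have h3 := frakc3D_re_bounds
  constructor <;> linarith [h1.1, h1.2, h2.1, h2.2, h3.1, h3.2]

/-! ## Non-closure of the final step at main order -/

/-- If `28.0792 ≤ c₂₃₂·c₂₃₃` the final step does not close: `|𝔡′ + 𝔡|² < 28.0792` (certified,
`dsum_normSq_bounds`). [cite: Zhang2022LandauSiegel, §2 (2.18), Props. 2.4–2.6] -/
theorem not_mainOrderContradiction_of_le {c232 c233 : ℝ} (h : 28.0792 ≤ c232 * c233) :
    ¬ MainOrderContradiction c232 c233 := by
  unfold MainOrderContradiction
  have h5 : (5 : ℝ) < ‖dprime + dfrak‖ := Prop24Main_holds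
  have hpos : (0 : ℝ) < ‖dprime + dfrak‖ := lt_trans (by norm_num) h5
  rw [Real.sqrt_lt' hpos, Complex.sq_norm]
  intro hlt
  linarith [dsum_normSq_bounds.2]

/-- For the certified `C₂₃₃`: the step does not close as soon as `c₂₃₂ ≥ 0.011026`
(`mainOrderContradiction_iff`, `mainOrder_threshold`). [cite: Zhang2022LandauSiegel, §2 (2.18), (2.32)–(2.33)] -/
theorem not_mainOrderContradiction_C233_of_le {c232 : ℝ} (h : 0.011026 ≤ c232) :
    ¬ MainOrderContradiction c232 C233 := by
  rw [mainOrderContradiction_iff]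
  have ht := mainOrder_threshold.1
  intro h'
  linarith

/-- For the fallback `c₂₃₃ = 8800/π` (`> 2793`): the step does not close as soon as `c₂₃₂ ≥ 0.0101`
(`28.0792·π/8800 < 0.010052`). [cite: Zhang2022LandauSiegel, §2 (2.33), §18 (18.3)] -/
theorem not_mainOrderContradiction_fallback_of_le {c232 : ℝ} (h : 0.0101 ≤ c232) :
    ¬ MainOrderContradiction c232 (8800 / π) := by
  apply not_mainOrderContradiction_of_le
  have hπ : π < 3.15 := Real.pi_lt_d2
  have hπ0 : 0 < π := Real.pi_pos
  rw [show c232 * (8800 / π) = c232 * 8800 / π by ring, le_div_iff₀ hπ0]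
  nlinarith

/-- **RT-08 terminal hypothesis of record is false**: `¬ MainOrderContradiction (𝔠₁ + 𝔠₂ᶜ + 2Re 𝔠₃ᴱ(e1ppD)) C₂₃₃`
— requirement `c₂₃₂ < |𝔡′ + 𝔡|²/C₂₃₃ < 0.011026`, certified `c₂₃₂ > 0.055328`.
[cite: Zhang2022LandauSiegel, §2 (2.18), (2.32)–(2.33); §18] -/
theorem not_mainOrderContradiction_cD :
    ¬ MainOrderContradiction (frakc1.re + frakc2c.re + 2 * (frakc3E e1ppD).re) C233 :=
  not_mainOrderContradiction_C233_of_le (by linarith [c232E_e1ppD_bounds.1])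

/-- The same at the STATED `e″` (`frakc3E e1ppj = frakc3`): certified `c₂₃₂ > 0.055194`.
[cite: Zhang2022LandauSiegel, §2 (2.18), (2.32)–(2.33); §18] -/
theorem not_mainOrderContradiction_cE :
    ¬ MainOrderContradiction (frakc1.re + frakc2c.re + 2 * (frakc3E e1ppj).re) C233 :=
  not_mainOrderContradiction_C233_of_le (by linarith [c232E_e1ppj_bounds.1])

/-- Derived `e″`, fallback `c₂₃₃ = 8800/π`. [cite: Zhang2022LandauSiegel, §2 (2.33); §18 (18.3)] -/
theorem not_mainOrderContradiction_cD_fallback :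
    ¬ MainOrderContradiction (frakc1.re + frakc2c.re + 2 * (frakc3E e1ppD).re) (8800 / π) :=
  not_mainOrderContradiction_fallback_of_le (by linarith [c232E_e1ppD_bounds.1])

/-- Stated `e″`, fallback `c₂₃₃ = 8800/π`. [cite: Zhang2022LandauSiegel, §2 (2.33); §18 (18.3)] -/
theorem not_mainOrderContradiction_cE_fallback :
    ¬ MainOrderContradiction (frakc1.re + frakc2c.re + 2 * (frakc3E e1ppj).re) (8800 / π) :=
  not_mainOrderContradiction_fallback_of_le (by linarith [c232E_e1ppj_bounds.1])

/-- Derived `e″`, printed `𝔠₂`, certified `C₂₃₃`. [cite: Zhang2022LandauSiegel, §2 (2.32); §18 (18.2)] -/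
theorem not_mainOrderContradiction_c2D :
    ¬ MainOrderContradiction (frakc1.re + frakc2.re + 2 * (frakc3E e1ppD).re) C233 :=
  not_mainOrderContradiction_C233_of_le (by linarith [c232E2_e1ppD_bounds.1])

/-- **All readings at once, with the quantitative gap**: the requirement is `c₂₃₂ < 0.011026`
(`< 0.010052` for the fallback `c₂₃₃`), every certified reading of `c₂₃₂` is `> 0.0551 > 5 × 0.011026`.
[cite: Zhang2022LandauSiegel, §2 (2.18), (2.32)–(2.33); §18] -/
theorem mainOrderE_refuted_all_readings :
    ¬ MainOrderContradiction (frakc1.re + frakc2c.re + 2 * (frakc3E e1ppD).re) C233 ∧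
    ¬ MainOrderContradiction (frakc1.re + frakc2c.re + 2 * (frakc3E e1ppj).re) C233 ∧
    ¬ MainOrderContradiction (frakc1.re + frakc2.re + 2 * (frakc3E e1ppD).re) C233 ∧
    ¬ MainOrderContradiction (frakc1.re + frakc2c.re + 2 * (frakc3E e1ppD).re) (8800 / π) ∧
    ¬ MainOrderContradiction (frakc1.re + frakc2c.re + 2 * (frakc3E e1ppj).re) (8800 / π) ∧
    Complex.normSq (dprime + dfrak) / C233 < 0.011026 ∧
    5 * 0.011026 < frakc1.re + frakc2c.re + 2 * (frakc3E e1ppD).re ∧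
    5 * 0.011026 < frakc1.re + frakc2c.re + 2 * (frakc3E e1ppj).re :=
  ⟨not_mainOrderContradiction_cD, not_mainOrderContradiction_cE, not_mainOrderContradiction_c2D,
    not_mainOrderContradiction_cD_fallback, not_mainOrderContradiction_cE_fallback,
    mainOrder_threshold.1, by linarith [c232E_e1ppD_bounds.1], by linarith [c232E_e1ppj_bounds.1]⟩

/-! ## The constant OF RECORD (ruling R-35b/c): tolerance `10⁻⁵` of (18.1) included, `k`-parametric

The discharge lane's terminal hypothesis reads `MainOrderContradiction (c232E e1ppD frakc2c.re) C233` with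
`c232E e1pp k := frakc1.re + k + 2 * ((frakc3E e1pp).re + 1e-5)` (the skeleton's definition; the
statements below are over the literal sum, i.e. its unfolding). -/

/-- **`0.055348 < 𝔠₁ + 𝔠₂ᶜ + 2·(Re 𝔠₃ᴱ(e1ppD) + 10⁻⁵) < 0.055363`** — the value of record `c232E e1ppD frakc2c.re`.
[cite: Zhang2022LandauSiegel, §18 (18.1)–(18.2), (2.32)] -/
theorem c232E_e1ppD_tol_bounds :
    (0.055348 : ℝ) < frakc1.re + frakc2c.re + 2 * ((frakc3E e1ppD).re + 1e-5) ∧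
      frakc1.re + frakc2c.re + 2 * ((frakc3E e1ppD).re + 1e-5) < 0.055363 := by
  have h := c232E_e1ppD_bounds
  constructor <;> linarith [h.1, h.2]

/-- **`0.055214 < 𝔠₁ + 𝔠₂ᶜ + 2·(Re 𝔠₃ᴱ(e1ppj) + 10⁻⁵) < 0.055227`** (stated `e″`).
[cite: Zhang2022LandauSiegel, §18 (18.1)–(18.2), (2.32)] -/
theorem c232E_e1ppj_tol_bounds :
    (0.055214 : ℝ) < frakc1.re + frakc2c.re + 2 * ((frakc3E e1ppj).re + 1e-5) ∧
      frakc1.re + frakc2c.re + 2 * ((frakc3E e1ppj).re + 1e-5) < 0.055227 := by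
  have h := c232E_e1ppj_bounds
  constructor <;> linarith [h.1, h.2]

/-- For every `𝔠₂`-reading `k ≥ 𝔠₂ᶜ` (in particular `k = frakc2c.re` and `k = frakc2.re`): the terminal
hypothesis of record at the DERIVED `e″` is false, `¬ MainOrderContradiction (c232E e1ppD k) C233`.
[cite: Zhang2022LandauSiegel, §2 (2.18), (2.32)–(2.33); §18] -/
theorem not_mainOrderContradiction_cD_with_of_le {k : ℝ} (hk : frakc2c.re ≤ k) :
    ¬ MainOrderContradiction (frakc1.re + k + 2 * ((frakc3E e1ppD).re + 1e-5)) C233 :=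
  not_mainOrderContradiction_C233_of_le (by linarith [c232E_e1ppD_tol_bounds.1])

/-- The same at the STATED `e″`, every `k ≥ 𝔠₂ᶜ`. [cite: Zhang2022LandauSiegel, §2 (2.18), (2.32)–(2.33); §18] -/
theorem not_mainOrderContradiction_cE_with_of_le {k : ℝ} (hk : frakc2c.re ≤ k) :
    ¬ MainOrderContradiction (frakc1.re + k + 2 * ((frakc3E e1ppj).re + 1e-5)) C233 :=
  not_mainOrderContradiction_C233_of_le (by linarith [c232E_e1ppj_tol_bounds.1])

/-- Fallback `c₂₃₃ = 8800/π`, derived `e″`, every `k ≥ 𝔠₂ᶜ`. [cite: Zhang2022LandauSiegel, §2 (2.33); §18 (18.3)] -/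
theorem not_mainOrderContradiction_cD_with_fallback_of_le {k : ℝ} (hk : frakc2c.re ≤ k) :
    ¬ MainOrderContradiction (frakc1.re + k + 2 * ((frakc3E e1ppD).re + 1e-5)) (8800 / π) :=
  not_mainOrderContradiction_fallback_of_le (by linarith [c232E_e1ppD_tol_bounds.1])

/-- Fallback `c₂₃₃ = 8800/π`, stated `e″`, every `k ≥ 𝔠₂ᶜ`. [cite: Zhang2022LandauSiegel, §2 (2.33); §18 (18.3)] -/
theorem not_mainOrderContradiction_cE_with_fallback_of_le {k : ℝ} (hk : frakc2c.re ≤ k) :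
    ¬ MainOrderContradiction (frakc1.re + k + 2 * ((frakc3E e1ppj).re + 1e-5)) (8800 / π) :=
  not_mainOrderContradiction_fallback_of_le (by linarith [c232E_e1ppj_tol_bounds.1])

/-- **The terminal hypothesis OF RECORD is false** (R-35b/c instance `k = frakc2c.re`): this is literally
`¬ MainOrderContradiction (c232E e1ppD frakc2c.re) C233` — requirement `< |𝔡′ + 𝔡|²/C₂₃₃ < 0.011026`,
certified `> 0.055348`. [cite: Zhang2022LandauSiegel, §2 (2.18), (2.32)–(2.33); §18] -/
theorem not_mainOrderContradiction_cD_record :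
    ¬ MainOrderContradiction (frakc1.re + frakc2c.re + 2 * ((frakc3E e1ppD).re + 1e-5)) C233 :=
  not_mainOrderContradiction_cD_with_of_le le_rfl

/-- Stated-`e″` twin of the record instance: `¬ MainOrderContradiction (c232E e1ppj frakc2c.re) C233`.
[cite: Zhang2022LandauSiegel, §2 (2.18), (2.32)–(2.33); §18] -/
theorem not_mainOrderContradiction_cE_record :
    ¬ MainOrderContradiction (frakc1.re + frakc2c.re + 2 * ((frakc3E e1ppj).re + 1e-5)) C233 :=
  not_mainOrderContradiction_cE_with_of_le le_rfl

/-- Printed-`𝔠₂` instance `k = frakc2.re` at the derived `e″`. [cite: Zhang2022LandauSiegel, §2 (2.32); §18 (18.2)] -/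
theorem not_mainOrderContradiction_c2D_record :
    ¬ MainOrderContradiction (frakc1.re + frakc2.re + 2 * ((frakc3E e1ppD).re + 1e-5)) C233 :=
  not_mainOrderContradiction_cD_with_of_le frakc2c_re_le_frakc2_re

/-- Record instances against the fallback `c₂₃₃ = 8800/π`. [cite: Zhang2022LandauSiegel, §2 (2.33); §18 (18.3)] -/
theorem not_mainOrderContradiction_record_fallback :
    ¬ MainOrderContradiction (frakc1.re + frakc2c.re + 2 * ((frakc3E e1ppD).re + 1e-5)) (8800 / π) ∧
    ¬ MainOrderContradiction (frakc1.re + frakc2c.re + 2 * ((frakc3E e1ppj).re + 1e-5)) (8800 / π) :=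
  ⟨not_mainOrderContradiction_cD_with_fallback_of_le le_rfl,
    not_mainOrderContradiction_cE_with_fallback_of_le le_rfl⟩

/-- **Summary over the constant of record**: all instances false, and the gap — requirement `< 0.011026`,
certified values `> 5 × 0.011026`. [cite: Zhang2022LandauSiegel, §2 (2.18), (2.32)–(2.33); §18] -/
theorem mainOrderE_record_refuted_all :
    ¬ MainOrderContradiction (frakc1.re + frakc2c.re + 2 * ((frakc3E e1ppD).re + 1e-5)) C233 ∧
    ¬ MainOrderContradiction (frakc1.re + frakc2c.re + 2 * ((frakc3E e1ppj).re + 1e-5)) C233 ∧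
    ¬ MainOrderContradiction (frakc1.re + frakc2.re + 2 * ((frakc3E e1ppD).re + 1e-5)) C233 ∧
    ¬ MainOrderContradiction (frakc1.re + frakc2c.re + 2 * ((frakc3E e1ppD).re + 1e-5)) (8800 / π) ∧
    ¬ MainOrderContradiction (frakc1.re + frakc2c.re + 2 * ((frakc3E e1ppj).re + 1e-5)) (8800 / π) ∧
    Complex.normSq (dprime + dfrak) / C233 < 0.011026 ∧
    5 * 0.011026 < frakc1.re + frakc2c.re + 2 * ((frakc3E e1ppD).re + 1e-5) ∧
    5 * 0.011026 < frakc1.re + frakc2c.re + 2 * ((frakc3E e1ppj).re + 1e-5) :=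
  ⟨not_mainOrderContradiction_cD_record, not_mainOrderContradiction_cE_record,
    not_mainOrderContradiction_c2D_record, not_mainOrderContradiction_record_fallback.1,
    not_mainOrderContradiction_record_fallback.2, mainOrder_threshold.1,
    by linarith [c232E_e1ppD_tol_bounds.1], by linarith [c232E_e1ppj_tol_bounds.1]⟩

end Literature.NumberTheory.LFunctions.Zhang2022
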